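import Mathlib
import Summits.SmoothPoincare4.SmoothPoincare4.Theses.CylinderEntropy
import Literature.Geometry.Riemannian.SphericalCylinderEntropy
import Literature.Geometry.Riemannian.TiltedSliceEntropy
import Literature.Geometry.Manifold.CylinderSlice
import Literature.Geometry.Manifold.BranchedFourSphere
import Literature.Geometry.Manifold.CorruptedAtlasSphere
import Literature.Topology.FourManifolds.CerfGammaFourProofs
import Literature.Topology.FourManifolds.SmoothPoincareLowDim

/-!
# Negative knowledge about crux E = `CylinderEntropy.ThinCrossSectionExists`: the load-bearing analysis of its frame

Supports item stmt-SmoothPoincare4-7633 (standing disprover, cycle 2).  E reads: every `M : Type` with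
`[TopologicalSpace M] [T2Space M] [SecondCountableTopology M] [ChartedSpace ℝ⁴ M] [IsManifold (𝓡 4) ∞ M]` and `M ≃ₕ S⁴` has a
`C^∞` embedding `ι : M → ℝ⁶` into `N = S⁴ × ℝ` separating the ends with typed cylinder entropy `< 4/e`.  Proved here, sorry-free:

* drop `M ≃ₕ S⁴` ⇒ FALSE (`false_without_homotopyEquiv`: the empty manifold);
* drop `[T2Space M]` ⇒ FALSE (`false_without_t2`: the branched 4-sphere of `Literature.Geometry.Manifold.BranchedFourSphere`);
* drop `[IsManifold (𝓡 4) ∞ M]` ⇒ FALSE (`false_without_isManifold`: the corrupted atlas of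
  `Literature.Geometry.Manifold.CorruptedAtlasSphere`);
* drop `[SecondCountableTopology M]` ⇒ EQUIVALENT to E (`withoutSecondCountable_iff_crux`: compactness from `H₄`,
  `compactSpace_of_homotopyEquiv`, `secondCountable_of_homotopyEquiv`);
* lower the threshold to any `c ≤ 1` ⇒ FALSE at `M = S⁴` (`false_at_threshold_le_one`: entropy floor `λ_cyl ≥ 1`);
* strengthen `∃ ι` to `∀ ι` ⇒ FALSE at `M = S⁴` (`not_forall_thin`: the fat tilted slice of
  `Literature.Geometry.Riemannian.TiltedSliceEntropy`);
* weaken `IsSmoothEmbedding ι` to `IsEmbedding ι` ⇒ TRUE given Freedman's theorem and the calibration item (`top_weakening`);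
* E ⇐ SPC4 given the calibration item (`crux_of_spc4`), so `¬E ⊢ ¬SPC4` (`not_spc4_of_not_crux`).
-/

noncomputable section

open scoped BigOperators Topology Manifold MeasureTheory ENNReal ContDiff ContinuousMap
open Set Function
open Literature.Geometry.Riemannian.SphericalCylinderEntropy (cylEntropy one_le_cylEntropy_of_separatesEnds)
open Literature.Geometry.Manifold.CylinderSlice (sliceMap range_sliceMap isSmoothEmbedding_sliceMap sum_sq_sliceMap
  separatesEnds_of_slice_subset)

-- the registered namespace `Summit.SmoothPoincare4.SmoothPoincare4.Theorems` repeats a component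
set_option linter.dupNamespace false

namespace Summit.SmoothPoincare4.SmoothPoincare4.Theorems.ThinCrossSectionExists.Negative

open Summit.SmoothPoincare4.SmoothPoincare4.Theses.CylinderEntropy (ThinCrossSectionExists SliceCalibration)

local notation "E⁶" => EuclideanSpace ℝ (Fin 6)
local notation "E⁴" => EuclideanSpace ℝ (Fin 4)
local notation "𝕊⁴" => (Metric.sphere (0 : EuclideanSpace ℝ (Fin 5)) 1)

/-! ## Dropping hypotheses -/

/-- **Drop `M ≃ₕ S⁴` ⇒ false** (at every threshold): the empty open submanifold of `ℝ⁴` has only the empty "cross-section", which does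
not separate the ends (the vertical segment over `e₀` joins them). [folklore] -/
theorem false_without_homotopyEquiv (c : ℝ≥0∞) :
    ¬ ∀ (M : Type) [TopologicalSpace M] [T2Space M] [SecondCountableTopology M] [ChartedSpace E⁴ M] [IsManifold (𝓡 4) ∞ M],
      ∃ ι : M → E⁶, Manifold.IsSmoothEmbedding (𝓡 4) (𝓡 6) ∞ ι ∧ (∀ x, ∑ i : Fin 5, ι x (Fin.castSucc i) ^ 2 = 1) ∧
        (∃ R : ℝ, ∀ a b : E⁶, ∑ i : Fin 5, a (Fin.castSucc i) ^ 2 = 1 → ∑ i : Fin 5, b (Fin.castSucc i) ^ 2 = 1 →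
          a 5 ≤ -R → R ≤ b 5 → ¬ JoinedIn ({z : E⁶ | ∑ i : Fin 5, z (Fin.castSucc i) ^ 2 = 1} \ Set.range ι) a b) ∧
        cylEntropy (Set.range ι) < c := by
  intro h
  obtain ⟨ι, -, -, ⟨R, hR⟩, -⟩ := h (⊥ : TopologicalSpace.Opens E⁴)
  have hempty : Set.range ι = ∅ := Set.range_eq_empty_iff.mpr ⟨fun x => (Set.mem_empty_iff_false _).mp x.2⟩
  let p : ℝ → E⁶ := fun t => EuclideanSpace.single (0 : Fin 6) (1 : ℝ) + EuclideanSpace.single (5 : Fin 6) t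
  have hp5 : ∀ t, p t 5 = t := fun t => by simp [p]
  have hpc : ∀ t (i : Fin 5), p t (Fin.castSucc i) = if i = 0 then 1 else 0 := fun t i => by
    fin_cases i <;> simp [p, Fin.ext_iff]
  have hpN : ∀ t, ∑ i : Fin 5, p t (Fin.castSucc i) ^ 2 = 1 := fun t => by simp [hpc]
  refine hR (p (-(|R| + 1))) (p (|R| + 1)) (hpN _) (hpN _) (by rw [hp5]; linarith [le_abs_self R])
    (by rw [hp5]; linarith [le_abs_self R]) ?_
  rw [hempty, Set.sdiff_empty]
  refine JoinedIn.of_segment_subset ?_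
  rintro z ⟨a, b, ha, hb, hab, rfl⟩
  have this : ∀ i : Fin 5, (a • p (-(|R| + 1)) + b • p (|R| + 1)) (Fin.castSucc i) = if i = 0 then 1 else 0 := by
    intro i; simp only [PiLp.add_apply, PiLp.smul_apply, smul_eq_mul, hpc]; split_ifs <;> nlinarith
  have goal : (a • p (-(|R| + 1)) + b • p (|R| + 1)) ∈ {z : E⁶ | ∑ i : Fin 5, z (Fin.castSucc i) ^ 2 = 1} := by
    simp only [Set.mem_setOf_eq, this]; simp
  exact goal

/-- **Drop `[T2Space M]` ⇒ false** (at every threshold): the branched 4-sphere is a second-countable `C^∞` 4-manifold `≃ₕ S⁴`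
with no smooth (indeed no topological) embedding into `ℝ⁶`, since it is not Hausdorff. [folklore] -/
theorem false_without_t2 (c : ℝ≥0∞) :
    ¬ ∀ (M : Type) [TopologicalSpace M] [SecondCountableTopology M] [ChartedSpace E⁴ M] [IsManifold (𝓡 4) ∞ M],
      M ≃ₕ 𝕊⁴ → ∃ ι : M → E⁶, Manifold.IsSmoothEmbedding (𝓡 4) (𝓡 6) ∞ ι ∧ (∀ x, ∑ i : Fin 5, ι x (Fin.castSucc i) ^ 2 = 1) ∧
        (∃ R : ℝ, ∀ a b : E⁶, ∑ i : Fin 5, a (Fin.castSucc i) ^ 2 = 1 → ∑ i : Fin 5, b (Fin.castSucc i) ^ 2 = 1 →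
          a 5 ≤ -R → R ≤ b 5 → ¬ JoinedIn ({z : E⁶ | ∑ i : Fin 5, z (Fin.castSucc i) ^ 2 = 1} \ Set.range ι) a b) ∧
        cylEntropy (Set.range ι) < c := by
  intro h
  obtain ⟨ι, hι, -⟩ := h Literature.Geometry.Manifold.BranchedFourSphere.X
    Literature.Geometry.Manifold.BranchedFourSphere.homotopyEquiv
  exact Literature.Geometry.Manifold.BranchedFourSphere.not_t2Space hι.isEmbedding.t2Space

/-- **Drop `[IsManifold (𝓡 4) ∞ M]` ⇒ false** (at every threshold): the 4-sphere with one corrupt chart added is a compact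
Hausdorff second-countable charted space `≃ₕ S⁴` out of which no map is a Mathlib `C^∞` immersion. [folklore] -/
theorem false_without_isManifold (c : ℝ≥0∞) :
    ¬ ∀ (M : Type) [TopologicalSpace M] [T2Space M] [SecondCountableTopology M] [ChartedSpace E⁴ M],
      M ≃ₕ 𝕊⁴ → ∃ ι : M → E⁶, Manifold.IsSmoothEmbedding (𝓡 4) (𝓡 6) ∞ ι ∧ (∀ x, ∑ i : Fin 5, ι x (Fin.castSucc i) ^ 2 = 1) ∧
        (∃ R : ℝ, ∀ a b : E⁶, ∑ i : Fin 5, a (Fin.castSucc i) ^ 2 = 1 → ∑ i : Fin 5, b (Fin.castSucc i) ^ 2 = 1 →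
          a 5 ≤ -R → R ≤ b 5 → ¬ JoinedIn ({z : E⁶ | ∑ i : Fin 5, z (Fin.castSucc i) ^ 2 = 1} \ Set.range ι) a b) ∧
        cylEntropy (Set.range ι) < c := by
  intro h
  obtain ⟨ι, hι, -⟩ := h Literature.Geometry.Manifold.CorruptedAtlasSphere.Cor
    Literature.Geometry.Manifold.CorruptedAtlasSphere.corHomotopyEquiv
  exact Literature.Geometry.Manifold.CorruptedAtlasSphere.not_isImmersion ι hι.isImmersion

/-- A Hausdorff 4-manifold `M : Type` (no countability assumed) homotopy equivalent to `S⁴` is compact: `H₄` of a connected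
non-compact Hausdorff manifold vanishes (tree theorem, Hatcher Prop. 3.29, countability-free) while `H₄(S⁴) ≠ 0`. [folklore] -/
theorem compactSpace_of_homotopyEquiv (M : Type) [TopologicalSpace M] [T2Space M] [ChartedSpace E⁴ M]
    (e : M ≃ₕ 𝕊⁴) : CompactSpace M := by
  by_contra hM
  haveI : NoncompactSpace M := not_compactSpace_iff.mp hM
  haveI := Literature.Topology.FourManifolds.pathConnectedSpace_euclideanSphere (n := 4) (by norm_num)
  haveI : PathConnectedSpace M := Literature.Topology.FourManifolds.pathConnectedSpace_of_homotopyEquiv e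
  have hz : CategoryTheory.Limits.IsZero
      (Literature.AlgebraicTopology.SingularHomology.singularHomology ℤ ℤ M 4) :=
    Literature.AlgebraicTopology.SingularHomology.isZero_singularHomology_of_noncompactSpace_holds ℤ M 4 le_rfl
  exact Literature.AlgebraicTopology.SingularHomology.not_isZero_singularHomology_unitSphere ℤ ℤ 4 (by norm_num)
    (hz.of_iso (Literature.AlgebraicTopology.SingularHomology.singularHomology.isoOfHomotopyEquiv ℤ ℤ e 4).symm)

/-- Hence such an `M` is second countable (finitely many chart domains cover). [folklore] -/
theorem secondCountable_of_homotopyEquiv (M : Type) [TopologicalSpace M] [T2Space M] [ChartedSpace E⁴ M]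
    (e : M ≃ₕ 𝕊⁴) : SecondCountableTopology M := by
  haveI := compactSpace_of_homotopyEquiv M e
  obtain ⟨s, -, hsfin, hcover⟩ := isCompact_univ.elim_finite_subcover_image
    (b := (univ : Set M)) (c := fun x : M => (chartAt E⁴ x).source) (fun x _ => (chartAt E⁴ x).open_source)
    (fun x _ => mem_iUnion₂.mpr ⟨x, mem_univ x, mem_chart_source E⁴ x⟩)
  exact ChartedSpace.secondCountable_of_countable_cover E⁴ (s := s) (univ_subset_iff.mp hcover) hsfin.countable

/-- **Drop `[SecondCountableTopology M]` ⇒ nothing changes**: the crux without second countability is equivalent to the crux. [folklore] -/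
theorem withoutSecondCountable_iff_crux :
    (∀ (M : Type) [TopologicalSpace M] [T2Space M] [ChartedSpace E⁴ M] [IsManifold (𝓡 4) ∞ M],
      M ≃ₕ 𝕊⁴ → ∃ ι : M → E⁶, Manifold.IsSmoothEmbedding (𝓡 4) (𝓡 6) ∞ ι ∧ (∀ x, ∑ i : Fin 5, ι x (Fin.castSucc i) ^ 2 = 1) ∧
        (∃ R : ℝ, ∀ a b : E⁶, ∑ i : Fin 5, a (Fin.castSucc i) ^ 2 = 1 → ∑ i : Fin 5, b (Fin.castSucc i) ^ 2 = 1 →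
          a 5 ≤ -R → R ≤ b 5 → ¬ JoinedIn ({z : E⁶ | ∑ i : Fin 5, z (Fin.castSucc i) ^ 2 = 1} \ Set.range ι) a b) ∧
        cylEntropy (Set.range ι) < ENNReal.ofReal (4 / Real.exp 1)) ↔
    ThinCrossSectionExists := by
  constructor
  · intro h M _ _ _ _ _ e; exact h M e
  · intro h M _ _ _ _ e
    haveI := secondCountable_of_homotopyEquiv M e
    exact h M e

/-! ## Thresholds and strengthenings -/

/-- **E with any threshold `c ≤ 1` is false**, already at `M = S⁴`: every compact continuous end-separating cross-section of `N` has
typed `λ_cyl ≥ 1` (area floor + large-scale limit of the kernel, tree file `SphericalCylinderEntropy`).  The route's free interval is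
exactly `[1, 4/e)`. [folklore] -/
theorem false_at_threshold_le_one {c : ℝ≥0∞} (hc : c ≤ 1) :
    ¬ ∀ (M : Type) [TopologicalSpace M] [T2Space M] [SecondCountableTopology M] [ChartedSpace E⁴ M] [IsManifold (𝓡 4) ∞ M],
      M ≃ₕ 𝕊⁴ → ∃ ι : M → E⁶, Manifold.IsSmoothEmbedding (𝓡 4) (𝓡 6) ∞ ι ∧ (∀ x, ∑ i : Fin 5, ι x (Fin.castSucc i) ^ 2 = 1) ∧
        (∃ R : ℝ, ∀ a b : E⁶, ∑ i : Fin 5, a (Fin.castSucc i) ^ 2 = 1 → ∑ i : Fin 5, b (Fin.castSucc i) ^ 2 = 1 →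
          a 5 ≤ -R → R ≤ b 5 → ¬ JoinedIn ({z : E⁶ | ∑ i : Fin 5, z (Fin.castSucc i) ^ 2 = 1} \ Set.range ι) a b) ∧
        cylEntropy (Set.range ι) < c := by
  intro h
  obtain ⟨ι, hι, hN, ⟨R, hR⟩, hlt⟩ := h 𝕊⁴ (ContinuousMap.HomotopyEquiv.refl _)
  have hcont : Continuous ι := hι.isEmbedding.continuous
  have hc5 : Continuous fun x => |ι x 5| := by fun_prop
  obtain ⟨B, hB⟩ := (isCompact_range hc5).isBounded.subset_closedBall_lt 0 0
  have hB' : ∀ z ∈ Set.range ι, |z 5| ≤ B := by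
    rintro z ⟨x, rfl⟩
    have := hB.2 (Set.mem_range_self x)
    simpa [Real.dist_eq, abs_abs] using this
  have h1 : 1 ≤ cylEntropy (Set.range ι) :=
    one_le_cylEntropy_of_separatesEnds (isCompact_range hcont).isClosed.measurableSet
      (by rintro z ⟨x, rfl⟩; exact hN x) hB' (R := R) hR
  exact absurd (lt_of_lt_of_le hlt hc) (not_lt.mpr h1)

/-- **The `∀`-strengthening of E is false at `S⁴`** (for every threshold `c ≤ 2`, in particular `4/e`): the tilted slice
`x ↦ (x, 1000 x₀)` is a smooth end-separating cross-section with typed `λ_cyl ≥ 2`. [folklore] -/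
theorem not_forall_thin {c : ℝ≥0∞} (hc : c ≤ 2) :
    ¬ ∀ (M : Type) [TopologicalSpace M] [T2Space M] [SecondCountableTopology M] [ChartedSpace E⁴ M] [IsManifold (𝓡 4) ∞ M],
      M ≃ₕ 𝕊⁴ → ∀ ι : M → E⁶, Manifold.IsSmoothEmbedding (𝓡 4) (𝓡 6) ∞ ι →
        (∀ x, ∑ i : Fin 5, ι x (Fin.castSucc i) ^ 2 = 1) →
        (∃ R : ℝ, ∀ a b : E⁶, ∑ i : Fin 5, a (Fin.castSucc i) ^ 2 = 1 → ∑ i : Fin 5, b (Fin.castSucc i) ^ 2 = 1 →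
          a 5 ≤ -R → R ≤ b 5 → ¬ JoinedIn ({z : E⁶ | ∑ i : Fin 5, z (Fin.castSucc i) ^ 2 = 1} \ Set.range ι) a b) →
        cylEntropy (Set.range ι) < c := by
  intro h
  have hlt := h 𝕊⁴ (ContinuousMap.HomotopyEquiv.refl _) (Literature.Geometry.Riemannian.TiltedSliceEntropy.tilt 1000)
    (Literature.Geometry.Riemannian.TiltedSliceEntropy.isSmoothEmbedding_tilt 1000)
    (Literature.Geometry.Riemannian.TiltedSliceEntropy.sum_sq_tilt 1000)
    (Literature.Geometry.Riemannian.TiltedSliceEntropy.separates_range_tilt 1000)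
  exact absurd (lt_of_lt_of_le hlt hc) (not_lt.mpr Literature.Geometry.Riemannian.TiltedSliceEntropy.two_le_cylEntropy_tilt)

/-! ## The regularity of `ι` carries SPC4 -/

/-- `1 < 4/e`. [folklore] -/
theorem one_lt_level : (1 : ℝ≥0∞) < ENNReal.ofReal (4 / Real.exp 1) := by
  rw [← ENNReal.ofReal_one]
  refine (ENNReal.ofReal_lt_ofReal_iff (by positivity)).mpr ?_
  rw [lt_div_iff₀ (Real.exp_pos 1)]
  have := Real.exp_one_lt_d9
  linarith

/-- **TOP-E is a theorem**: with `IsSmoothEmbedding ι` weakened to a topological embedding, every homotopy 4-sphere has a thin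
cross-section, GIVEN Freedman's theorem (tree fact `nonempty_homeomorph_sphere_four`) and the calibration item (the slice through a
homeomorphism `M ≃ₜ S⁴`).  So all SPC4 content of E is the upgrade `C⁰ → C^∞` of one map. [folklore] -/
theorem top_weakening (hF : Literature.Topology.FourManifolds.nonempty_homeomorph_sphere_four.{0})
    (hcal : SliceCalibration) :
    ∀ (M : Type) [TopologicalSpace M] [T2Space M] [SecondCountableTopology M] [ChartedSpace E⁴ M] [IsManifold (𝓡 4) ∞ M],
      M ≃ₕ 𝕊⁴ → ∃ ι : M → E⁶, Topology.IsEmbedding ι ∧ (∀ x, ∑ i : Fin 5, ι x (Fin.castSucc i) ^ 2 = 1) ∧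
        (∃ R : ℝ, ∀ a b : E⁶, ∑ i : Fin 5, a (Fin.castSucc i) ^ 2 = 1 → ∑ i : Fin 5, b (Fin.castSucc i) ^ 2 = 1 →
          a 5 ≤ -R → R ≤ b 5 → ¬ JoinedIn ({z : E⁶ | ∑ i : Fin 5, z (Fin.castSucc i) ^ 2 = 1} \ Set.range ι) a b) ∧
        cylEntropy (Set.range ι) < ENNReal.ofReal (4 / Real.exp 1) := by
  intro M _ _ _ _ _ e
  obtain ⟨φ⟩ := hF M e
  have hr : Set.range (sliceMap 0 ∘ φ) = {z : E⁶ | ∑ i : Fin 5, z (Fin.castSucc i) ^ 2 = 1 ∧ z 5 = 0} := by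
    rw [Set.range_comp, φ.surjective.range_eq, Set.image_univ, range_sliceMap]
  refine ⟨sliceMap 0 ∘ φ, (isSmoothEmbedding_sliceMap 0).isEmbedding.comp φ.isEmbedding,
    fun x => sum_sq_sliceMap 0 (φ x), ?_, ?_⟩
  · rw [hr]; exact separatesEnds_of_slice_subset subset_rfl
  · rw [hr, show cylEntropy {z : E⁶ | ∑ i : Fin 5, z (Fin.castSucc i) ^ 2 = 1 ∧ z 5 = 0} = 1 from hcal]
    exact one_lt_level

/-- **E ⇐ SPC4** (given the calibration item): transport the slice along the diffeomorphism `M ≅ S⁴`. [folklore] -/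
theorem crux_of_spc4 (hcal : SliceCalibration) (h : _root_.SmoothPoincare4) : ThinCrossSectionExists := by
  intro M _ _ _ _ _ e
  obtain ⟨φ⟩ := h M ‹ChartedSpace E⁴ M› ‹IsManifold (𝓡 4) ∞ M› e
  have hr : Set.range (sliceMap 0 ∘ φ) = {z : E⁶ | ∑ i : Fin 5, z (Fin.castSucc i) ^ 2 = 1 ∧ z 5 = 0} := by
    rw [← range_sliceMap 0]
    ext z
    simp only [Set.mem_range, Function.comp_apply]
    constructor
    · rintro ⟨x, rfl⟩; exact ⟨φ x, rfl⟩
    · rintro ⟨y, rfl⟩; exact ⟨φ.symm y, by simp⟩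
  refine ⟨sliceMap 0 ∘ φ, (isSmoothEmbedding_sliceMap 0).comp_diffeomorph φ, fun x => sum_sq_sliceMap 0 (φ x), ?_, ?_⟩
  · rw [hr]; exact separatesEnds_of_slice_subset subset_rfl
  · show cylEntropy (Set.range (sliceMap 0 ∘ φ)) < ENNReal.ofReal (4 / Real.exp 1)
    rw [hr, show cylEntropy {z : E⁶ | ∑ i : Fin 5, z (Fin.castSucc i) ^ 2 = 1 ∧ z 5 = 0} = 1 from hcal]
    exact one_lt_level

/-- **A refutation of E is a disproof of SPC4** (given the calibration item) — why E resists every cheap attack. [folklore] -/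
theorem not_spc4_of_not_crux (hcal : SliceCalibration) (h : ¬ ThinCrossSectionExists) : ¬ _root_.SmoothPoincare4 :=
  fun hs => h (crux_of_spc4 hcal hs)

end Summit.SmoothPoincare4.SmoothPoincare4.Theorems.ThinCrossSectionExists.Negative

end
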